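import Mathlib.RingTheory.MvPowerSeries.Expand
import Mathlib.RingTheory.MvPowerSeries.NoZeroDivisors
import Mathlib.Algebra.CharP.Algebra
import Mathlib.Algebra.CharP.Reduced
import Mathlib.FieldTheory.IntermediateField.Basic
import Mathlib.LinearAlgebra.Basis.VectorSpace
import Mathlib.LinearAlgebra.FiniteDimensional.Defs
import HarnessLib

/-!
# `k⟦X⟧` over `k'⟦X^p⟧` for a cofinite subfield `k' ⊇ k^p` (Matsumura, proof of Thm. 30.9)

Topic: `Literature/AlgebraicGeometry/Resolution`. Power-series input for Nagata's family in the
proof of Matsumura's Thm. 32.3 (leaf `Stacks07PH_finite_regular` of `FormalFibresRegular.lean`):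
p. 258, "set `R_α = k_α⟦X_1^p, …, X_n^p⟧` … `S` is a finite module over `S_α`", and the proof of
Thm. 30.9, p. 243: "`B` is the free `C'`-module with basis the set of `p`-monomials …
`K_α ∩ B = C_α`. From this one deduces easily that `⋂_α K_α = K^p`." For a field `k` of
characteristic `p`, `R = k⟦X_1, …, X_n⟧` and a subfield `k' ⊆ k`:

* `pSeriesSubring p k'` — the subring `k'⟦X^p⟧ ⊆ R` of series supported on exponents
  divisible by `p` with coefficients in `k'`.
* `pow_char_mem_pSeriesSubring` — `R^p ⊆ k'⟦X^p⟧` when `k^p ⊆ k'` (Mathlib's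
  `MvPowerSeries.map_frobenius_expand`: `(Σ a_m X^m)^p = Σ a_m^p X^{pm}`).
* `exists_pow_eq_of_forall_coeff` — a series supported on `pℕ^n` with coefficients in `k^p` is a
  `p`-th power in `R`.
* `pComponent`, `eq_sum_pComponent`, `mem_span_pMonomials` — **expansion** of every
  `φ ∈ R` as a finite sum `Σ_{λ,e} b_λ X^{ν(e)} φ_{λ,e}` over a `k'`-basis `(b_λ)` of `k` and the
  `p`-monomials `X^{ν(e)}` (`0 ≤ e_i < p`) with `φ_{λ,e} ∈ k'⟦X^p⟧` (so `R` is a finitely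
  generated `k'⟦X^p⟧`-module when `[k : k'] < ∞`; Matsumura p. 258: "`S` is a finite module
  over `S_α`").
* `pComponent_eq_of_eq_sum` — **uniqueness** of the expansion (the `p`-monomials times the
  `b_λ` form a basis, Matsumura p. 243), and its consequence
  `mem_pSeriesSubring_of_mul_mem` — **`R ∩ Frac k'⟦X^p⟧ = k'⟦X^p⟧`** ("`K_α ∩ B = C_α`"): if
  `d·g = c` with `c, d ∈ k'⟦X^p⟧`, `d ≠ 0`, then `g ∈ k'⟦X^p⟧`.
* `exists_basis_apply_eq_one` — a finite `k/k'` has a `k'`-basis containing `1`.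

## Sources

* H. Matsumura, *Commutative Ring Theory*, CUP 1986: proof of Thm. 30.9, p. 243 [PDF 261];
  proof of Thm. 32.3, p. 258 [276]. [Matsumura1987]
-/

noncomputable section

open MvPowerSeries

namespace Literature.AlgebraicGeometry.Resolution

universe u

variable {k : Type u} [Field k] (p : ℕ) {n : ℕ}

/-! ## The subring `k'⟦X^p⟧` -/

/-- **`k'⟦X_1^p, …, X_n^p⟧ ⊆ k⟦X_1, …, X_n⟧`**: the power series all of whose exponents are
divisible by `p` and all of whose coefficients lie in the subfield `k'` (Matsumura p. 258:
"`R_α = k_α⟦X_1^p, …, X_n^p⟧`"). [cite: Matsumura1987, §32 p. 258, proof of Thm. 32.3] -/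
def pSeriesSubring (k' : Subfield k) : Subring (MvPowerSeries (Fin n) k) where
  carrier := {φ | ∀ m : Fin n →₀ ℕ, coeff m φ ∈ k' ∧ ((∃ i, ¬ p ∣ m i) → coeff m φ = 0)}
  mul_mem' {φ ψ} hφ hψ := by
    classical
    intro m
    rw [coeff_mul]
    refine ⟨k'.sum_mem fun x _ => k'.mul_mem (hφ x.1).1 (hψ x.2).1, ?_⟩
    rintro ⟨i, hi⟩
    refine Finset.sum_eq_zero fun x hx => ?_
    have hx' : x.1 + x.2 = m := Finset.mem_antidiagonal.mp hx
    by_cases h1 : p ∣ x.1 i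
    · have h2 : ¬ p ∣ x.2 i := fun h2 => hi (by
        rw [← hx', Finsupp.add_apply]
        exact dvd_add h1 h2)
      rw [(hψ x.2).2 ⟨i, h2⟩, mul_zero]
    · rw [(hφ x.1).2 ⟨i, h1⟩, zero_mul]
  one_mem' := by
    classical
    intro m
    rw [coeff_one]
    split_ifs with hm
    · exact ⟨k'.one_mem, fun ⟨i, hi⟩ => absurd (by rw [hm]; exact dvd_zero p) hi⟩
    · exact ⟨k'.zero_mem, fun _ => rfl⟩
  add_mem' {φ ψ} hφ hψ m := by
    rw [map_add]
    exact ⟨k'.add_mem (hφ m).1 (hψ m).1, fun h => by rw [(hφ m).2 h, (hψ m).2 h, add_zero]⟩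
  zero_mem' m := by
    rw [map_zero]
    exact ⟨k'.zero_mem, fun _ => rfl⟩
  neg_mem' {φ} hφ m := by
    rw [map_neg]
    exact ⟨k'.neg_mem (hφ m).1, fun h => by rw [(hφ m).2 h, neg_zero]⟩

/-- Membership in `k'⟦X^p⟧`. [folklore] -/
theorem mem_pSeriesSubring_iff (k' : Subfield k) (φ : MvPowerSeries (Fin n) k) :
    φ ∈ pSeriesSubring p k' ↔
      ∀ m : Fin n →₀ ℕ, coeff m φ ∈ k' ∧ ((∃ i, ¬ p ∣ m i) → coeff m φ = 0) :=
  Iff.rfl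

/-- `k'⟦X^p⟧` is monotone in `k'`. [folklore] -/
theorem pSeriesSubring_mono {k' k'' : Subfield k} (h : k' ≤ k'') :
    pSeriesSubring (n := n) p k' ≤ pSeriesSubring p k'' :=
  fun _ hφ m => ⟨h (hφ m).1, (hφ m).2⟩

/-! ## `p`-th powers -/

section Frobenius

variable [Fact p.Prime] [CharP k p]

/-- Coefficients of a `p`-th power: `(Σ a_m X^m)^p = Σ a_m^p X^{pm}` (Mathlib's
`MvPowerSeries.map_frobenius_expand`). [folklore] -/
theorem coeff_pow_char (φ : MvPowerSeries (Fin n) k) (m : Fin n →₀ ℕ) :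
    coeff m (φ ^ p) = (coeff m (expand p (Fact.out : p.Prime).ne_zero φ)) ^ p := by
  rw [← map_frobenius_expand p (Fact.out : p.Prime).ne_zero, coeff_map, frobenius_def]

/-- **`R^p ⊆ k'⟦X^p⟧`** when `k^p ⊆ k'`. [cite: Matsumura1987, §30 p. 243, proof of Thm. 30.9] -/
theorem pow_char_mem_pSeriesSubring (k' : Subfield k) (hk' : ∀ a : k, a ^ p ∈ k')
    (φ : MvPowerSeries (Fin n) k) : φ ^ p ∈ pSeriesSubring p k' := by
  have hp : p.Prime := Fact.out
  intro m
  rw [coeff_pow_char]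
  refine ⟨hk' _, ?_⟩
  rintro ⟨i, hi⟩
  rw [coeff_expand_of_not_dvd p hp.ne_zero φ hi, zero_pow hp.ne_zero]

/-- **A series supported on `pℕ^n` with coefficients in `k^p` is a `p`-th power**
(converse of `pow_char_mem_pSeriesSubring` for `k' = k^p`).
[cite: Matsumura1987, §30 p. 243, proof of Thm. 30.9] -/
theorem exists_pow_eq_of_forall_coeff (ψ : MvPowerSeries (Fin n) k)
    (h1 : ∀ m : Fin n →₀ ℕ, ∃ b : k, b ^ p = coeff m ψ)
    (h2 : ∀ m : Fin n →₀ ℕ, (∃ i, ¬ p ∣ m i) → coeff m ψ = 0) :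
    ∃ φ : MvPowerSeries (Fin n) k, φ ^ p = ψ := by
  classical
  have hp : p.Prime := Fact.out
  choose b hb using h1
  refine ⟨fun m => b (p • m), ?_⟩
  ext m
  rw [coeff_pow_char]
  by_cases hm : ∀ i, p ∣ m i
  · -- `m = p • m'`
    choose c hc using hm
    have hmeq : m = p • (Finsupp.equivFunOnFinite.symm c : Fin n →₀ ℕ) := by
      ext i
      simp [hc i]
    rw [hmeq, coeff_expand_smul]
    exact hb _
  · push Not at hm
    rw [coeff_expand_of_not_dvd p hp.ne_zero _ hm.choose_spec, zero_pow hp.ne_zero, h2 m hm]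

end Frobenius

/-! ## Expansion of `k⟦X⟧` over `k'⟦X^p⟧` along a `k'`-basis of `k` and the `p`-monomials -/

section Expansion

variable [Fact p.Prime] (k' : Subfield k) {ι : Type*} [Fintype ι] (b : Module.Basis ι k' k)

/-- The exponent `ν(e) = (e_1, …, e_n)` attached to residues `e : Fin n → Fin p`. [folklore] -/
def residueExponent (e : Fin n → Fin p) : Fin n →₀ ℕ :=
  Finsupp.equivFunOnFinite.symm fun i => (e i : ℕ)

omit [Fact p.Prime] in
/-- Components of `ν(e)`. [folklore] -/
@[simp]
theorem residueExponent_apply (e : Fin n → Fin p) (i : Fin n) : residueExponent p e i = e i :=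
  rfl

/-- The residues of an exponent `M` modulo `p`. [folklore] -/
def exponentMod (M : Fin n →₀ ℕ) : Fin n → Fin p :=
  fun i => ⟨M i % p, Nat.mod_lt _ (Fact.out : p.Prime).pos⟩

/-- `ν(M mod p) ≤ M`. [folklore] -/
theorem residueExponent_exponentMod_le (M : Fin n →₀ ℕ) :
    residueExponent p (exponentMod p M) ≤ M :=
  fun _ => Nat.mod_le _ _

/-- `M - ν(M mod p)` is divisible by `p`. [folklore] -/
theorem dvd_sub_residueExponent_exponentMod (M : Fin n →₀ ℕ) (i : Fin n) :
    p ∣ (M - residueExponent p (exponentMod p M)) i := by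
  rw [Finsupp.tsub_apply, residueExponent_apply]
  change p ∣ M i - M i % p
  exact Nat.dvd_sub_mod (M i)

/-- The only residue vector `e` with `ν(e) ≤ M` and `p ∣ M - ν(e)` is `M mod p`. [folklore] -/
theorem eq_exponentMod_of_le_of_dvd {M : Fin n →₀ ℕ} {e : Fin n → Fin p}
    (hle : residueExponent p e ≤ M) (hdvd : ∀ i, p ∣ (M - residueExponent p e) i) :
    e = exponentMod p M := by
  funext i
  apply Fin.ext
  change (e i : ℕ) = M i % p
  have h1 : (e i : ℕ) ≤ M i := hle i
  have h2 : p ∣ M i - e i := by simpa [Finsupp.tsub_apply] using hdvd i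
  obtain ⟨c, hc⟩ := h2
  have hM : M i = p * c + e i := by omega
  rw [hM, Nat.mul_add_mod, Nat.mod_eq_of_lt (e i).2]

/-- **The `k'⟦X^p⟧`-component of `φ` along `b_λ X^{ν(e)}`**: the series
`Σ_m coord_λ(a_{pm + ν(e)}) X^{pm}`. [cite: Matsumura1987, §30 p. 243, proof of Thm. 30.9] -/
def pComponent (φ : MvPowerSeries (Fin n) k) (l : ι) (e : Fin n → Fin p) :
    MvPowerSeries (Fin n) k :=
  fun M => if ∀ i, p ∣ M i then (b.repr (coeff (M + residueExponent p e) φ) l : k) else 0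

omit [Fact p.Prime] [Fintype ι] in
/-- Coefficients of `pComponent`. [folklore] -/
theorem coeff_pComponent (φ : MvPowerSeries (Fin n) k) (l : ι) (e : Fin n → Fin p)
    (M : Fin n →₀ ℕ) :
    coeff M (pComponent p k' b φ l e) =
      if ∀ i, p ∣ M i then (b.repr (coeff (M + residueExponent p e) φ) l : k) else 0 :=
  rfl

omit [Fact p.Prime] [Fintype ι] in
/-- `pComponent φ λ e ∈ k'⟦X^p⟧`. [cite: Matsumura1987, §30 p. 243, proof of Thm. 30.9] -/
theorem pComponent_mem (φ : MvPowerSeries (Fin n) k) (l : ι) (e : Fin n → Fin p) :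
    pComponent p k' b φ l e ∈ pSeriesSubring p k' := by
  intro M
  rw [coeff_pComponent]
  split_ifs with h
  · exact ⟨Subtype.mem _, fun ⟨i, hi⟩ => absurd (h i) hi⟩
  · exact ⟨k'.zero_mem, fun _ => rfl⟩

/-- **Expansion of `k⟦X⟧` over `k'⟦X^p⟧`**: every `φ ∈ k⟦X_1, …, X_n⟧` is the (finite) sum over a
`k'`-basis `(b_λ)` of `k` and the `p`-monomials `X^{ν(e)}`, `0 ≤ e_i < p`, of
`b_λ X^{ν(e)} φ_{λ,e}` with `φ_{λ,e} ∈ k'⟦X^p⟧` (Matsumura p. 243: "`B` is the free `C'`-module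
with basis the set of `p`-monomials in `u_1, …, u_r, x_1, …, x_n`"; we only use that these
generate). [cite: Matsumura1987, §30 p. 243, proof of Thm. 30.9] -/
theorem eq_sum_pComponent (φ : MvPowerSeries (Fin n) k) :
    φ = ∑ l, ∑ e : Fin n → Fin p,
      C (b l) * (monomial (residueExponent p e) (1 : k) * pComponent p k' b φ l e) := by
  classical
  ext M
  simp only [map_sum, coeff_C_mul, coeff_monomial_mul, one_mul, coeff_pComponent]
  -- only `e = M mod p` contributes
  have key : ∀ l, (∑ e : Fin n → Fin p, b l * (if residueExponent p e ≤ M then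
      (if ∀ i, p ∣ (M - residueExponent p e) i then
        (b.repr (coeff (M - residueExponent p e + residueExponent p e) φ) l : k) else 0) else 0)) =
      b l * (b.repr (coeff M φ) l : k) := by
    intro l
    rw [Finset.sum_eq_single (exponentMod p M)]
    · rw [if_pos (residueExponent_exponentMod_le p M),
        if_pos (dvd_sub_residueExponent_exponentMod p M),
        tsub_add_cancel_of_le (residueExponent_exponentMod_le p M)]
    · intro e _ hne
      split_ifs with h1 h2
      · exact absurd (eq_exponentMod_of_le_of_dvd p h1 h2) hne
      · rw [mul_zero]
      · rw [mul_zero]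
    · intro h
      exact absurd (Finset.mem_univ _) h
  simp only [key]
  -- `Σ_λ b_λ coord_λ(a_M) = a_M`
  have h := b.sum_repr (coeff M φ)
  simp only [Subfield.smul_def, smul_eq_mul] at h
  rw [show (∑ l, b l * (b.repr (coeff M φ) l : k)) = ∑ l, (b.repr (coeff M φ) l : k) * b l from
    Finset.sum_congr rfl fun l _ => mul_comm _ _]
  exact h.symm

/-- **`k⟦X⟧` is generated over `k'⟦X^p⟧` by the finitely many `b_λ X^{ν(e)}`** (Matsumura
p. 258: "`S` is a finite module over `S_α`" at the level of `R` over `R_α`): every `φ` lies in the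
`k'⟦X^p⟧`-span of `{b_λ X^{ν(e)}}`. [cite: Matsumura1987, §32 p. 258, proof of Thm. 32.3] -/
theorem mem_span_pMonomials (φ : MvPowerSeries (Fin n) k) :
    φ ∈ Submodule.span (pSeriesSubring (n := n) p k')
      (Set.range fun le : ι × (Fin n → Fin p) =>
        C (b le.1) * monomial (residueExponent p le.2) (1 : k)) := by
  classical
  rw [eq_sum_pComponent p k' b φ]
  refine Submodule.sum_mem _ fun l _ => Submodule.sum_mem _ fun e _ => ?_
  have : C (b l) * (monomial (residueExponent p e) (1 : k) * pComponent p k' b φ l e) =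
      (⟨pComponent p k' b φ l e, pComponent_mem p k' b φ l e⟩ : pSeriesSubring p k') •
        (C (b l) * monomial (residueExponent p e) (1 : k)) := by
    change _ = pComponent p k' b φ l e * (C (b l) * monomial (residueExponent p e) 1)
    ring
  rw [this]
  exact Submodule.smul_mem _ _ (Submodule.subset_span ⟨(l, e), rfl⟩)

/-- **Uniqueness of the expansion**: the `k'⟦X^p⟧`-coefficients of an expansion
`Φ = Σ_{λ,e} b_λ X^{ν(e)} ψ_{λ,e}` are the `pComponent`s of `Φ` (Matsumura p. 243: the
`p`-monomials form a *basis*). [cite: Matsumura1987, §30 p. 243, proof of Thm. 30.9] -/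
theorem pComponent_eq_of_eq_sum (ψ : ι → (Fin n → Fin p) → MvPowerSeries (Fin n) k)
    (hψ : ∀ l e, ψ l e ∈ pSeriesSubring p k') (Φ : MvPowerSeries (Fin n) k)
    (hΦ : Φ = ∑ l, ∑ e : Fin n → Fin p,
      C (b l) * (monomial (residueExponent p e) (1 : k) * ψ l e)) (l : ι) (e : Fin n → Fin p) :
    pComponent p k' b Φ l e = ψ l e := by
  classical
  have hp : p.Prime := Fact.out
  ext M
  rw [coeff_pComponent]
  by_cases hM : ∀ i, p ∣ M i
  · rw [if_pos hM]
    -- the coefficient of `Φ` at `M + ν(e)`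
    have hmod : exponentMod p (M + residueExponent p e) = e := by
      funext i
      apply Fin.ext
      change (M i + (e i : ℕ)) % p = e i
      obtain ⟨c, hc⟩ := hM i
      rw [hc, Nat.mul_add_mod, Nat.mod_eq_of_lt (e i).2]
    have hsub : M + residueExponent p e - residueExponent p e = M := add_tsub_cancel_right _ _
    have hcoeff : coeff (M + residueExponent p e) Φ = ∑ l', (b l' : k) * coeff M (ψ l' e) := by
      rw [hΦ]
      simp only [map_sum, coeff_C_mul, coeff_monomial_mul, one_mul]
      refine Finset.sum_congr rfl fun l' _ => ?_
      rw [Finset.sum_eq_single e]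
      · rw [if_pos le_add_self, hsub]
      · intro e' _ hne
        split_ifs with h1
        · -- `e' ≠ e` forces a non-`p`-divisible exponent, where `ψ` vanishes
          have : ¬ ∀ i, p ∣ (M + residueExponent p e - residueExponent p e') i := fun h2 =>
            hne ((eq_exponentMod_of_le_of_dvd p h1 h2).trans hmod)
          push Not at this
          rw [((hψ l' e') _).2 this, mul_zero]
        · rw [mul_zero]
      · intro h
        exact absurd (Finset.mem_univ _) h
    -- apply `coord_λ`: the coefficients `coeff M (ψ λ' e) ∈ k'`
    have hrepr : b.repr (coeff (M + residueExponent p e) Φ) =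
        Finsupp.equivFunOnFinite.symm fun l' => ⟨coeff M (ψ l' e), ((hψ l' e) M).1⟩ := by
      rw [hcoeff]
      have : (∑ l', (b l' : k) * coeff M (ψ l' e)) =
          ∑ l', (⟨coeff M (ψ l' e), ((hψ l' e) M).1⟩ : k') • b l' := by
        refine Finset.sum_congr rfl fun l' _ => ?_
        rw [Subfield.smul_def, smul_eq_mul, mul_comm]
      rw [this, map_sum]
      ext l'
      simp [Finsupp.finsetSum_apply, Module.Basis.repr_self, Finsupp.single_apply]
    rw [hrepr]
    rfl
  · rw [if_neg hM]
    push Not at hM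
    exact (((hψ l e) M).2 hM).symm

/-- **`k⟦X⟧ ∩ Frac k'⟦X^p⟧ = k'⟦X^p⟧`** in the form used (Matsumura p. 243: "`K_α ∩ B = C_α`"):
if `d·g = c` with `c, d ∈ k'⟦X^p⟧`, `d ≠ 0` and `g ∈ k⟦X⟧`, then `g ∈ k'⟦X^p⟧` — expand `g`
along a `k'`-basis `(b_λ)` of `k` with `b_{λ₀} = 1`; by uniqueness the expansion of `c = d·g`
is concentrated on the basis vector `1`. [cite: Matsumura1987, §30 p. 243, proof of Thm. 30.9] -/
theorem mem_pSeriesSubring_of_mul_mem {l₀ : ι} (hb : b l₀ = 1) {g c d : MvPowerSeries (Fin n) k}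
    (hc : c ∈ pSeriesSubring p k') (hd : d ∈ pSeriesSubring p k') (hd0 : d ≠ 0)
    (hdg : d * g = c) : g ∈ pSeriesSubring p k' := by
  classical
  -- the expansion of `c = d g` with coefficients `d · g_{λ,e}`
  set ψ : ι → (Fin n → Fin p) → MvPowerSeries (Fin n) k := fun l e => d * pComponent p k' b g l e
  have hψ : ∀ l e, ψ l e ∈ pSeriesSubring p k' := fun l e =>
    (pSeriesSubring p k').mul_mem hd (pComponent_mem p k' b g l e)
  have hc_exp : c = ∑ l, ∑ e : Fin n → Fin p,
      C (b l) * (monomial (residueExponent p e) (1 : k) * ψ l e) := by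
    rw [← hdg, eq_sum_pComponent p k' b g, Finset.mul_sum]
    refine Finset.sum_congr rfl fun l _ => ?_
    rw [Finset.mul_sum]
    refine Finset.sum_congr rfl fun e _ => ?_
    simp only [ψ]
    ring
  -- the expansion of `c` concentrated at `(λ₀, 0)`
  set ψ' : ι → (Fin n → Fin p) → MvPowerSeries (Fin n) k :=
    fun l e => if l = l₀ ∧ e = (fun _ => ⟨0, (Fact.out : p.Prime).pos⟩) then c else 0
  have hψ' : ∀ l e, ψ' l e ∈ pSeriesSubring p k' := fun l e => by
    simp only [ψ']
    split_ifs
    · exact hc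
    · exact (pSeriesSubring p k').zero_mem
  have he0 : residueExponent p (fun _ : Fin n => (⟨0, (Fact.out : p.Prime).pos⟩ : Fin p)) = 0 := by
    ext i
    rfl
  have hc_exp' : c = ∑ l, ∑ e : Fin n → Fin p,
      C (b l) * (monomial (residueExponent p e) (1 : k) * ψ' l e) := by
    rw [Finset.sum_eq_single l₀, Finset.sum_eq_single (fun _ => ⟨0, (Fact.out : p.Prime).pos⟩)]
    · simp only [ψ', if_pos (And.intro rfl rfl), hb, map_one, one_mul, he0]
      rw [show (monomial (0 : Fin n →₀ ℕ) (1 : k)) = 1 from rfl, one_mul]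
    · intro e _ hne
      have : ¬ (l₀ = l₀ ∧ e = fun _ => (⟨0, (Fact.out : p.Prime).pos⟩ : Fin p)) := fun h => hne h.2
      simp only [ψ', if_neg this, mul_zero]
    · intro h; exact absurd (Finset.mem_univ _) h
    · intro l _ hne
      refine Finset.sum_eq_zero fun e _ => ?_
      simp [ψ', hne]
    · intro h; exact absurd (Finset.mem_univ _) h
  -- uniqueness: `d · g_{λ,e} = ψ' λ e`
  have huniq : ∀ l e, ψ l e = ψ' l e := fun l e => by
    rw [← pComponent_eq_of_eq_sum p k' b ψ hψ c hc_exp l e,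
      pComponent_eq_of_eq_sum p k' b ψ' hψ' c hc_exp' l e]
  -- hence `g_{λ,e} = 0` off `(λ₀, 0)` and `g = g_{λ₀,0}`
  have hzero : ∀ l e, ¬ (l = l₀ ∧ e = fun _ => ⟨0, (Fact.out : p.Prime).pos⟩) →
      pComponent p k' b g l e = 0 := fun l e hne => by
    have h := huniq l e
    simp only [ψ, ψ', if_neg hne] at h
    exact (mul_eq_zero.mp h).resolve_left hd0
  have hg : g = pComponent p k' b g l₀ (fun _ => ⟨0, (Fact.out : p.Prime).pos⟩) := by
    conv_lhs => rw [eq_sum_pComponent p k' b g]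
    rw [Finset.sum_eq_single l₀, Finset.sum_eq_single (fun _ => ⟨0, (Fact.out : p.Prime).pos⟩)]
    · rw [hb, map_one, one_mul, he0, show (monomial (0 : Fin n →₀ ℕ) (1 : k)) = 1 from rfl,
        one_mul]
    · intro e _ hne
      rw [hzero l₀ e (fun h => hne h.2), mul_zero, mul_zero]
    · intro h; exact absurd (Finset.mem_univ _) h
    · intro l _ hne
      refine Finset.sum_eq_zero fun e _ => ?_
      rw [hzero l e (fun h => hne h.1), mul_zero, mul_zero]
    · intro h; exact absurd (Finset.mem_univ _) h
  rw [hg]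
  exact pComponent_mem p k' b g _ _

end Expansion

/-- A finite extension `k/k'` has a `k'`-basis containing `1`. [folklore] -/
theorem exists_basis_apply_eq_one (k' : Subfield k) [FiniteDimensional k' k] :
    ∃ (ι : Type u) (_ : Fintype ι) (b : Module.Basis ι k' k) (l₀ : ι), b l₀ = 1 := by
  classical
  have hli : LinearIndepOn k' (id : k → k) ({1} : Set k) :=
    LinearIndepOn.singleton (v := (id : k → k)) one_ne_zero
  let b := Module.Basis.extend hli
  haveI : Finite (hli.extend (Set.subset_univ _)) := Module.Finite.finite_basis b
  refine ⟨hli.extend (Set.subset_univ _), Fintype.ofFinite _, b,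
    ⟨1, Module.Basis.subset_extend hli (Set.mem_singleton 1)⟩, ?_⟩
  exact Module.Basis.extend_apply_self hli _

end Literature.AlgebraicGeometry.Resolution

end
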